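import Summits.QuantumAdvantage.AdviceFreeQNC0.WalkTransport
import Summits.QuantumAdvantage.AdviceFreeQNC0.OddPrimeStatements
import Literature.Computability.MetaComplexity.LowDegreeComposition

set_option linter.dupNamespace false

/-!
# Symmetry law (lens 4, g29): the walk game is invariant under reversal–complement

An EXACT symmetry of the walk game `ringWinU` (every `n`, every charge `c`), found on the extremal / normal-form side of the
lens: with `σ u := (¬u_{n−1}, …, ¬u_0)` (reverse AND complement) the cut residues satisfy
`r_g(σ u) ≡ r_{n−g}(u) (mod 3)` (`residue_sigma`; complement alone gives `r_g(ū) ≡ 2c + n − r_g(u)`, reversal alone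
`r_g(rev u) ≡ 2c + n − r_{n−g}(u)` — only the composite fixes the charge), hence the conjugate strategy
`ySigma y g u := y (n − g) (σ u)` has `ringWinU c (ySigma y) u = ringWinU c y (σ u)` (`ringWinU_ySigma`): conjugates of perfect
strategies are perfect (`perfect_ySigma`), and for odd `n = 2m+1` every perfect strategy has a `σ`-SYMMETRIC perfect companion
`symmetrize y m` (glue `y` on `u_m = 0` with `ySigma y` on `u_m = 1`; `symmetrize_perfect`, `ySigma_symmetrize`) — a normal form
costing one degree (`hasDegF_ySigma`, `hasDegF_symmetrize`: conjugation preserves the `𝔽_p`-degree, symmetrisation adds one).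
No other non-trivial hypercube symmetry preserves all residues for all charges (the residue of the empty cut pins `wt u mod 3`,
and `r_{g+1} − r_g = 1 + u_g` pins the order of the bits up to this reflection).
Supports stmt-QuantumAdvantage-28487 (record; the residual `X = AbsorptionDial.NoPerfectPolyOdd` is NOT claimed).
-/

namespace Summit.QuantumAdvantage.QuantumAdvantage.Theorems.SymmetryLaw

open Finset Summit.QuantumAdvantage.AdviceFreeQNC0
open Literature.Computability.MetaComplexity Literature.Computability.MetaComplexity.Smolensky

variable {n : ℕ}

/-- the reversal–complement involution `σ u = (¬u_{n−1}, …, ¬u_0)` -/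
def sigma (u : Fin n → Bool) : Fin n → Bool := fun i => !u (Fin.rev i)

/-- unfolding lemma -/
theorem sigma_apply (u : Fin n → Bool) (i : Fin n) : sigma u i = !u (Fin.rev i) := rfl

/-- `σ` is an involution -/
theorem sigma_sigma (u : Fin n → Bool) : sigma (sigma u) = u := by
  funext i
  simp [sigma, Fin.rev_rev]

/-- the `σ`-conjugate strategy: register `g` of `ySigma y` is register `n − g` of `y`, read at `σ u` -/
def ySigma (y : Fin (n + 1) → (Fin n → Bool) → Bool) : Fin (n + 1) → (Fin n → Bool) → Bool :=
  fun g u => y (Fin.rev g) (sigma u)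

/-- unfolding lemma -/
theorem ySigma_apply (y : Fin (n + 1) → (Fin n → Bool) → Bool) (g : Fin (n + 1)) (u : Fin n → Bool) :
    ySigma y g u = y (Fin.rev g) (sigma u) := rfl

/-- conjugation is an involution -/
theorem ySigma_ySigma (y : Fin (n + 1) → (Fin n → Bool) → Bool) : ySigma (ySigma y) = y := by
  funext g u
  simp [ySigma, Fin.rev_rev, sigma_sigma]

/-- reindexing a count along `Fin.rev`: if `Q i ↔ P (rev i)` then `#Q = #P` -/
theorem card_filter_rev {m : ℕ} (P Q : Fin m → Prop) [DecidablePred P] [DecidablePred Q] (h : ∀ i, Q i ↔ P (Fin.rev i)) :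
    (univ.filter Q).card = (univ.filter P).card := by
  refine card_bij (fun i _ => Fin.rev i) (fun i hi => ?_) (fun i₁ _ i₂ _ h => Fin.rev_injective h) (fun j hj => ?_)
  · rw [mem_filter] at hi ⊢
    exact ⟨mem_univ _, (h i).mp hi.2⟩
  · refine ⟨Fin.rev j, ?_, Fin.rev_rev j⟩
    rw [mem_filter] at hj ⊢
    exact ⟨mem_univ _, (h _).mpr (by rw [Fin.rev_rev]; exact hj.2)⟩

/-- the number of ones of `u` at positions `≥ m` -/
def wtSuffix (u : Fin n → Bool) (m : ℕ) : ℕ := (univ.filter fun i : Fin n => m ≤ i.val ∧ u i = true).card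

/-- weight of the conjugate: `wt (σ u) + wt u = n` -/
theorem wt_sigma_add (u : Fin n → Bool) : wt (sigma u) + wt u = n := by
  unfold wt
  have h1 := card_filter_rev (fun j : Fin n => u j = false) (fun i : Fin n => sigma u i = true) (fun i => by simp [sigma])
  rw [h1]
  have h2 : (univ.filter fun j : Fin n => u j = true) = univ.filter fun j => ¬ (u j = false) := by
    refine filter_congr fun j _ => ?_
    simp
  rw [h2, card_filter_add_card_filter_not, card_univ, Fintype.card_fin]

/-- prefix weight of the conjugate: `W_g(σ u) + #{ones of u at positions ≥ n − g} = g` (`g ≤ n`) -/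
theorem wtPrefix_sigma_add (u : Fin n → Bool) {g : ℕ} (hg : g ≤ n) : wtPrefix (sigma u) g + wtSuffix u (n - g) = g := by
  unfold wtPrefix wtSuffix
  have h1 := card_filter_rev (fun j : Fin n => n - g ≤ j.val ∧ u j = false)
    (fun i : Fin n => i.val < g ∧ sigma u i = true) (fun i => by
      simp only [sigma, Fin.val_rev, Bool.not_eq_true']
      constructor
      · rintro ⟨hi, hu⟩; exact ⟨by omega, hu⟩
      · rintro ⟨hi, hu⟩; exact ⟨by omega, hu⟩)
  rw [h1]
  have h2 : (univ.filter fun j : Fin n => n - g ≤ j.val ∧ u j = true) =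
      (univ.filter fun j : Fin n => n - g ≤ j.val).filter fun j => ¬ (u j = false) := by
    ext j; simp
  have h3 : (univ.filter fun j : Fin n => n - g ≤ j.val ∧ u j = false) =
      (univ.filter fun j : Fin n => n - g ≤ j.val).filter fun j => u j = false := by
    ext j; simp
  rw [h2, h3, card_filter_add_card_filter_not]
  have h4 : (univ.filter fun j : Fin n => n - g ≤ j.val) = univ.filter fun j : Fin n => ¬ (j.val < n - g) := by
    refine filter_congr fun j _ => ?_
    omega
  have h5 := card_filter_add_card_filter_not (s := (univ : Finset (Fin n))) (fun j : Fin n => j.val < n - g)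
  rw [Fin.card_filter_val_lt, card_univ, Fintype.card_fin] at h5
  rw [h4]
  omega

/-- splitting the weight at position `m`: `W_m(u) + #{ones at positions ≥ m} = wt u` -/
theorem wtPrefix_add_wtSuffix (u : Fin n → Bool) (m : ℕ) : wtPrefix u m + wtSuffix u m = wt u := by
  unfold wtPrefix wtSuffix wt
  have h2 : (univ.filter fun j : Fin n => j.val < m ∧ u j = true) =
      (univ.filter fun j : Fin n => u j = true).filter fun j => j.val < m := by
    ext j; simp [and_comm]
  have h3 : (univ.filter fun j : Fin n => m ≤ j.val ∧ u j = true) =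
      (univ.filter fun j : Fin n => u j = true).filter fun j => ¬ (j.val < m) := by
    ext j; simp [and_comm]
  rw [h2, h3, card_filter_add_card_filter_not]

/-- **EXACT RESIDUE SYMMETRY**: the residue of cut `g` at `σ u` is the residue of cut `n − g` at `u` (mod `3`), for every
charge `c`. -/
theorem residue_sigma (c : ℕ) (u : Fin n → Bool) {g : ℕ} (hg : g ≤ n) :
    (c + g + walkExp (sigma u) g) % 3 = (c + (n - g) + walkExp u (n - g)) % 3 := by
  unfold walkExp
  have h1 := wt_sigma_add u
  have h2 := wtPrefix_sigma_add u hg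
  have h3 := wtPrefix_add_wtSuffix u (n - g)
  omega

/-- **SYMMETRY LAW**: the conjugate strategy wins at `u` exactly when the original wins at `σ u`. -/
theorem ringWinU_ySigma (c : ℕ) (y : Fin (n + 1) → (Fin n → Bool) → Bool) (u : Fin n → Bool) :
    ringWinU c (ySigma y) u = ringWinU c y (sigma u) := by
  unfold ringWinU
  have hS := card_filter_rev
    (fun h : Fin (n + 1) => y h (sigma u) = true ∧ (c + h.val + walkExp (sigma u) h.val) % 3 ≠ 0)
    (fun g : Fin (n + 1) => ySigma y g u = true ∧ (c + g.val + walkExp u g.val) % 3 ≠ 0) (fun g => by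
      have hgn : g.val ≤ n := Nat.lt_succ_iff.mp g.isLt
      have hrev : (Fin.rev g).val = n - g.val := by rw [Fin.val_rev]; omega
      have key := residue_sigma c u (g := n - g.val) (Nat.sub_le n g.val)
      rw [Nat.sub_sub_self hgn] at key
      rw [ySigma_apply, hrev, key])
  rw [hS]

/-- conjugates of perfect strategies are perfect -/
theorem perfect_ySigma {c : ℕ} {y : Fin (n + 1) → (Fin n → Bool) → Bool} (h : ∀ u, ringWinU c y u = true)
    (u : Fin n → Bool) : ringWinU c (ySigma y) u = true := by
  rw [ringWinU_ySigma]; exact h _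

/-- a losing input of the conjugate is the conjugate of a losing input -/
theorem ringWinU_ySigma_eq_false_iff {c : ℕ} {y : Fin (n + 1) → (Fin n → Bool) → Bool} (u : Fin n → Bool) :
    ringWinU c (ySigma y) u = false ↔ ringWinU c y (sigma u) = false := by
  rw [ringWinU_ySigma]

section Symmetrize

/-- the symmetrised strategy: `y` on the half-cube `u_m = 0`, its conjugate on `u_m = 1` -/
def symmetrize (y : Fin (n + 1) → (Fin n → Bool) → Bool) (m : Fin n) : Fin (n + 1) → (Fin n → Bool) → Bool :=
  fun g u => if u m = true then ySigma y g u else y g u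

/-- the symmetrised strategy of a perfect strategy is perfect (pointwise in `u` it IS one of two perfect strategies) -/
theorem symmetrize_perfect {c : ℕ} {y : Fin (n + 1) → (Fin n → Bool) → Bool} (h : ∀ u, ringWinU c y u = true) (m : Fin n)
    (u : Fin n → Bool) : ringWinU c (symmetrize y m) u = true := by
  cases hum : u m
  · have hsy : ∀ g, symmetrize y m g u = y g u := fun g => by simp [symmetrize, hum]
    have : ringWinU c (symmetrize y m) u = ringWinU c y u := by
      unfold ringWinU; simp only [hsy]
    rw [this]; exact h u
  · have hsy : ∀ g, symmetrize y m g u = ySigma y g u := fun g => by simp [symmetrize, hum]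
    have : ringWinU c (symmetrize y m) u = ringWinU c (ySigma y) u := by
      unfold ringWinU; simp only [hsy]
    rw [this]; exact perfect_ySigma h u

/-- for odd `n = 2m + 1` the middle position is fixed by reversal -/
theorem rev_mid {m : ℕ} (hn : n = 2 * m + 1) (i : Fin n) (hi : i.val = m) : Fin.rev i = i := by
  apply Fin.ext
  rw [Fin.val_rev]
  omega

/-- **σ-SYMMETRIC NORMAL FORM** (odd `n = 2m+1`): the symmetrised strategy is its own conjugate. -/
theorem ySigma_symmetrize {m : ℕ} (hn : n = 2 * m + 1) (y : Fin (n + 1) → (Fin n → Bool) → Bool) (i : Fin n)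
    (hi : i.val = m) : ySigma (symmetrize y i) = symmetrize y i := by
  funext g u
  have hri : Fin.rev i = i := rev_mid hn i hi
  simp only [ySigma_apply, symmetrize, sigma_apply, hri]
  cases hu : u i
  · -- `u_m = 0`: `(σ u)_m = 1`, the conjugate branch of the conjugate is `y` itself
    simp only [Bool.not_false, if_true]
    show ySigma y (Fin.rev g) (sigma u) = y g u
    rw [ySigma_apply, Fin.rev_rev, sigma_sigma]
  · simp only [Bool.not_true]
    rfl

end Symmetrize

section Degree

/-- the coordinates of `σ` are affine: `[σ u]_i = 1 − u_{rev i}` has degree `≤ 1` -/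
theorem indicator_sigma_mem_lowDeg_one (F : Type*) [Field F] (i : Fin n) :
    (fun u : Fin n → Bool => if sigma u i = true then (1 : F) else 0) ∈ lowDeg F n 1 := by
  have h1 : (fun u : Fin n → Bool => if sigma u i = true then (1 : F) else 0) = 1 - mono F {Fin.rev i} := by
    funext u
    rw [Pi.sub_apply, Pi.one_apply, mono_apply]
    simp only [sigma_apply, mem_singleton, forall_eq]
    rcases Bool.eq_false_or_eq_true (u (Fin.rev i)) with h | h <;> simp [h]
  rw [h1]
  refine Submodule.sub_mem _ ?_ (mono_mem_lowDeg (by simp))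
  rw [← mono_empty]
  exact mono_mem_lowDeg (by simp)

variable {p : ℕ} [Fact p.Prime]

/-- conjugation preserves the `𝔽_p`-degree: `deg (ySigma y g) ≤ deg (y (n − g))` -/
theorem hasDegF_ySigma {d : ℕ} {y : Fin (n + 1) → (Fin n → Bool) → Bool} (g : Fin (n + 1))
    (hy : HasDegF p (y (Fin.rev g)) d) : HasDegF p (ySigma y g) d :=
  Smolensky.comp_mem_lowDeg_of_coord sigma (fun i => indicator_sigma_mem_lowDeg_one (ZMod p) i) hy

/-- a strategy of degree `d` has a conjugate of degree `d` -/
theorem hasDegF_ySigma_all {d : ℕ} {y : Fin (n + 1) → (Fin n → Bool) → Bool} (hy : ∀ g, HasDegF p (y g) d)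
    (g : Fin (n + 1)) : HasDegF p (ySigma y g) d :=
  hasDegF_ySigma g (hy _)

/-- **the normal form costs one degree**: `deg (symmetrize y m g) ≤ d + 1` -/
theorem hasDegF_symmetrize {d : ℕ} {y : Fin (n + 1) → (Fin n → Bool) → Bool} (hy : ∀ g, HasDegF p (y g) d) (m : Fin n)
    (g : Fin (n + 1)) : HasDegF p (symmetrize y m g) (d + 1) := by
  unfold HasDegF
  have h : (fun x : Fin n → Bool => if symmetrize y m g x = true then (1 : ZMod p) else 0) =
      mono (ZMod p) {m} * (fun x => if ySigma y g x = true then (1 : ZMod p) else 0)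
        + (1 - mono (ZMod p) {m}) * (fun x => if y g x = true then (1 : ZMod p) else 0) := by
    funext x
    rw [Pi.add_apply, Pi.mul_apply, Pi.mul_apply, Pi.sub_apply, Pi.one_apply, mono_apply]
    simp only [symmetrize, mem_singleton, forall_eq]
    rcases Bool.eq_false_or_eq_true (x m) with h | h <;> simp [h]
  rw [h]
  have hm : mono (ZMod p) ({m} : Finset (Fin n)) ∈ lowDeg (ZMod p) n 1 := mono_mem_lowDeg (by simp)
  have hm' : (1 : CubeFn (ZMod p) n) - mono (ZMod p) {m} ∈ lowDeg (ZMod p) n 1 := by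
    refine Submodule.sub_mem _ ?_ hm
    rw [← mono_empty]
    exact mono_mem_lowDeg (by simp)
  have h1 := mul_mem_lowDeg_add hm (hasDegF_ySigma_all hy g)
  have h2 := mul_mem_lowDeg_add hm' (hy g)
  rw [Nat.add_comm] at h1 h2
  exact Submodule.add_mem _ h1 h2

end Degree

end Summit.QuantumAdvantage.QuantumAdvantage.Theorems.SymmetryLaw
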